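import Summits.ValiantsHypothesis.ValiantsHypothesis.Theorems.BarrierLeverSuccinctHittingSetsForVPKRSTEdge
import Summits.ValiantsHypothesis.ValiantsHypothesis.Theorems.BarrierLeverSuccinctHittingSetsForVPKRSTDoor
import Literature.Computability.AlgebraicComplexity.CircuitConstantCount

/-!
# Route BarrierLever — item `KRSTNoGoBelow6c` (stmt-ValiantsHypothesis-19093): KRST's generator is
# not `VP_{n,b}`-succinct for any `b < 6c` (the unconditional no-go band of record, both grades)

Lean text after the cell planner seat `valiant-natproofs-p2` (gen 3; HOME/Sketch-p2g3.lean §9,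
tree-ready extraction HOME/KRSTNoGoBelow6c-p2g3.lean, referee REF-P2G3 / REF-P2G3B PASS), landed
by the prover seat over the TREE's declarations: `KRSTEdge.krstGen`, `KRSTEdge.krstGen_transversal`,
`KRSTEdge.gval_binMono_two`, `KRSTEdge.not_idealSuccinct_of_transversal` (…KRSTEdgeTransversal /
…KRSTEdge) and the constant-count equation
`Literature.Computability.AlgebraicComplexity.exists_equation_of_complexity_le`
(`CircuitConstantCount.lean`: polynomials of circuit complexity `≤ s` satisfy a nonzero equation
on ANY `4s + 2` coordinates).

MECHANISM (transcendence-degree edge, sharper than the Raz-parametrisation edge of …KRSTEdge, whose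
band was `5b + 24 ≤ 6c`): KRST's generator (KI generator of `Perm_[p]` over the Reed–Solomon design,
block `m = n^{3c}`, `p` the least prime `≥ m² + n + 1 ≥ n^{6c}`) has a VARIABLE TRANSVERSAL of size
`min(p, 2^n)` at design abscissa `2` (`krstGen_transversal`); the class `SmallCircuits ℂ n b` has a
nonzero equation on any `k = n^{b+1} > 4 n^b + 1` of these coordinates; an equation pulled back
along a variable transversal does not vanish (`not_idealSuccinct_of_transversal`). Band arithmetic:
`4 n^b + 1 < n^{b+1} ≤ n^{6c} ≤ p` and `n^{b+1} ≤ 2^n` eventually.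

* `krst_not_idealSuccinct_of_lt` — fixed parameters: `2 ≤ m`, `m² ≤ p`, `4 n^b + 1 < k ≤ min(p, 2^n)`
  ⇒ KRST's generator is not ideal-succinct for `SmallCircuits ℂ n b`.
* `krst_not_idealSuccinct_eventually_of_lt` — eventual form: all large `n`, all primes
  `p ≥ n^{b+1}`, all `2 ≤ m`, `m² ≤ p`.
* **`krstNoGoBelow6c`** — the signature of item stmt-ValiantsHypothesis-19093 VERBATIM:
  `∀ c b, b < 6c → ¬ (∃ n₀, ∀ n ≥ n₀, IsIdealSuccinctGenerator (degLEMonomials n) (SmallCircuits ℂ n b)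
  (KRST generator, m = n^{3c}, p = leastPrimeGe (m² + n + 1)))`; `krstNoGoBelow6c_perSeed` — the
  per-seed grade (per-seed ⇒ ideal over a field, `KRSTEdge.IsSuccinctGenerator.ideal`).
* `not_KRSTSuccinctInVP_of_lt` — the Literature/KRSTDoor hypothesis `KRSTDoor.KRSTSuccinctInVP ℂ c b`
  is false for every `b < 6c` (successor of `KRSTEdge.not_KRSTSuccinctInVP`, band `5b + 24 ≤ 6c`);
  `lt_of_KRSTSuccinctInVP'` — it is satisfiable only if `6c ≤ b`.

WHAT THIS IS NOT: not a lower bound (a pure dimension / transcendence-degree count); one generator,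
one design; says nothing for `b ≥ 6c` (there the `p²`-dimensional seed exceeds every counting
method; the [B05]-conditional extension `b < 12c` is item stmt-ValiantsHypothesis-19340, not landed
here), nothing about FSV Question 6 / crux stmt-ValiantsHypothesis-14610, `VP` vs `VNP`.

References: [KumarRamyaSaptharishiTengse2022] §3.3–§3.5 (the generator), §4 (open problem 1);
[BurgisserClausenShokrollahi1997] §9.1, Thm. (9.13) (constant count); [ForbesShpilkaVolk2018] Def. 7.
-/

-- layout Summits/ValiantsHypothesis/ValiantsHypothesis forces the duplicated namespace component
set_option linter.dupNamespace false

noncomputable section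

namespace Summit.ValiantsHypothesis.ValiantsHypothesis.Theorems.BarrierLever.SuccinctHittingSetsForVP

namespace KRSTEdge

open Literature.Barriers.ValiantsHypothesis Literature.Computability.AlgebraicComplexity
  Literature.Computability.MetaComplexity MvPolynomial
open Summit.ValiantsHypothesis.ValiantsHypothesis.Theorems.BarrierLever.SuccinctHittingSetsForVP KRSTDoor

/-! ### The transcendence-degree edge at fixed parameters -/

/-- **KRST's generator is not IDEAL-succinct for `SmallCircuits ℂ n b` once
`4 n^b + 1 < k ≤ min(p, 2^n)`** (`2 ≤ m`, `m² ≤ p`; unconditional, no hardness hypothesis): the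
class has a nonzero equation on the `k` binary coordinates `x^{bits(w)}`, `w < k`
(`exists_equation_of_complexity_le`, constant count), the generator has a variable transversal there
(`krstGen_transversal`, `gval_binMono_two`), and an equation pulled back along a variable
transversal does not vanish on the generator (`not_idealSuccinct_of_transversal`). -/
theorem krst_not_idealSuccinct_of_lt {p n m b k : ℕ} [Fact p.Prime] (hm : 2 ≤ m) (hmp : m * m ≤ p)
    (hkp : k ≤ p) (hkn : k ≤ 2 ^ n) (hk : 4 * n ^ b + 1 < k) :
    ¬ IsIdealSuccinctGenerator (degLEMonomials n) (SmallCircuits ℂ n b) (krstGen ℂ p n hmp) := by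
  intro hsucc
  obtain ⟨H, hH⟩ := krstGen_transversal ℂ hm hmp (n := n)
  let E : Fin k → degLEMonomials n := fun w => binMono n w
  let ν : Fin k → ZMod p := fun w => ((w : ℕ) : ZMod p)
  have hE : ∀ w : Fin k, bind₁ H (krstGen ℂ p n hmp (E w)) = X (ν w) := fun w => by
    rw [hH, gval_binMono_two (lt_of_lt_of_le w.isLt hkn)]
  have hν : Function.Injective ν := by
    intro w w' h
    have h' := (ZMod.natCast_eq_natCast_iff' _ _ _).mp h
    rw [Nat.mod_eq_of_lt (lt_of_lt_of_le w.isLt hkp),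
      Nat.mod_eq_of_lt (lt_of_lt_of_le w'.isLt hkp)] at h'
    exact Fin.ext h'
  obtain ⟨D₀, hD0, hvan⟩ := exists_equation_of_complexity_le (F := ℂ) (σ := Fin n) (n ^ b) hk
    (fun w => ((E w : degLEMonomials n) : Fin n →₀ ℕ))
  refine not_idealSuccinct_of_transversal hE hν hD0 (fun g hg => hvan g ?_) hsucc
  have hg' : g.totalDegree ≤ n ∧ complexity g ≤ n ^ b := hg
  exact hg'.2

/-- Per-seed form at fixed parameters, in the shape of the Literature predicate `KRSTSuccinctIn`
(every seed's output polynomial lies in the class): it FAILS under the hypotheses of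
`krst_not_idealSuccinct_of_lt` (per-seed ⇒ ideal over a field). -/
theorem krst_not_succinctIn_of_lt {p n m b k : ℕ} [Fact p.Prime] (hm : 2 ≤ m) (hmp : m * m ≤ p)
    (hkp : k ≤ p) (hkn : k ≤ 2 ^ n) (hk : 4 * n ^ b + 1 < k) :
    ¬ (∀ y : ZMod p × ZMod p → ℂ, ∃ g ∈ SmallCircuits ℂ n b, ∀ μ : degLEMonomials n,
        coeff (μ : Fin n →₀ ℕ) g = eval (y ∘ krstDesign p n μ) (perPad ℂ hmp)) := by
  intro h
  refine krst_not_idealSuccinct_of_lt hm hmp hkp hkn hk (IsSuccinctGenerator.ideal fun y => ?_)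
  obtain ⟨g, hg, hcoeff⟩ := h y
  refine ⟨g, hg, funext fun μ => ?_⟩
  rw [coeffVector_apply, hcoeff μ, genOutput, krstGen, designGenerator, eval_rename]

/-! ### Band arithmetic and the eventual form -/

/-- `4 n^b + 2 ≤ n^(b+1)` once `n ≥ 6`. -/
theorem four_mul_pow_add_two_le {n : ℕ} (b : ℕ) (hn : 6 ≤ n) : 4 * n ^ b + 2 ≤ n ^ (b + 1) := by
  have h1 : 1 ≤ n ^ b := Nat.one_le_pow _ _ (by omega)
  calc 4 * n ^ b + 2 ≤ 4 * n ^ b + 2 * n ^ b := by omega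
    _ = 6 * n ^ b := by ring
    _ ≤ n * n ^ b := Nat.mul_le_mul_right _ hn
    _ = n ^ (b + 1) := by ring

/-- **The transcendence-degree edge, eventual form.** For every `b` there is `n₀` such that for all
`n ≥ n₀`, every prime `p ≥ n^(b+1)` and every `2 ≤ m`, `m² ≤ p`, KRST's generator is not
ideal-succinct (a fortiori not per-seed succinct) for `SmallCircuits ℂ n b` (take `k = n^(b+1)`:
`4 n^b + 1 < n^(b+1) ≤ min(p, 2^n)`). -/
theorem krst_not_idealSuccinct_eventually_of_lt (b : ℕ) : ∃ n₀ : ℕ, ∀ n : ℕ, n₀ ≤ n →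
    ∀ (p m : ℕ) [Fact p.Prime], 2 ≤ m → (hmp : m * m ≤ p) → n ^ (b + 1) ≤ p →
      ¬ IsIdealSuccinctGenerator (degLEMonomials n) (SmallCircuits ℂ n b) (krstGen ℂ p n hmp) := by
  obtain ⟨n₂, hn₂⟩ := LowDegreeEquations.eventually_mul_pow_le_two_pow 1 (b + 1)
  refine ⟨n₂ + 6, fun n hn p m _ hm hmp hkp => ?_⟩
  have hk : 4 * n ^ b + 1 < n ^ (b + 1) := four_mul_pow_add_two_le b (by omega)
  have hkn : n ^ (b + 1) ≤ 2 ^ n := by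
    have h2 := hn₂ n (by omega)
    rwa [one_mul] at h2
  exact krst_not_idealSuccinct_of_lt hm hmp hkp hkn hk

/-! ### Item `KRSTNoGoBelow6c` (stmt-ValiantsHypothesis-19093), verbatim, and its per-seed grade -/

/-- **`KRSTNoGoBelow6c`** (ledger item stmt-ValiantsHypothesis-19093, D-0059 home of the V4 no-go
band of record; signature character for character): for EVERY hardness exponent `c` and EVERY
`b < 6c`, KRST's generator (block `m = n^{3c}`, `p` the least prime `≥ m² + n + 1`) is NOT
eventually ideal-succinct for `SmallCircuits ℂ n b`. Unconditional. Proof: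
`krst_not_idealSuccinct_eventually_of_lt` with `n^{b+1} ≤ n^{6c} = m² ≤ p`. -/
theorem krstNoGoBelow6c : ∀ c b : ℕ, b < 6 * c → ¬ (∃ n₀ : ℕ, ∀ n ≥ n₀, Summit.ValiantsHypothesis.ValiantsHypothesis.Theorems.BarrierLever.SuccinctHittingSetsForVP.KRSTEdge.IsIdealSuccinctGenerator (Literature.Barriers.ValiantsHypothesis.degLEMonomials n) (Literature.Barriers.ValiantsHypothesis.SmallCircuits ℂ n b) (@Summit.ValiantsHypothesis.ValiantsHypothesis.Theorems.BarrierLever.SuccinctHittingSetsForVP.KRSTEdge.krstGen ℂ _ (Literature.Computability.MetaComplexity.leastPrimeGe (n ^ (3 * c) * n ^ (3 * c) + n + 1)) n ⟨(Literature.Computability.MetaComplexity.leastPrimeGe_spec (n ^ (3 * c) * n ^ (3 * c) + n + 1)).2⟩ (n ^ (3 * c)) (le_trans (Nat.le_add_right (n ^ (3 * c) * n ^ (3 * c)) (n + 1)) (Literature.Computability.MetaComplexity.leastPrimeGe_spec (n ^ (3 * c) * n ^ (3 * c) + n + 1)).1))) := by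
  rintro c b hbc ⟨n₀, h⟩
  obtain ⟨n₁, hn₁⟩ := krst_not_idealSuccinct_eventually_of_lt b
  have key : ∀ n : ℕ, n₀ + n₁ + 2 ≤ n → False := by
    intro n hn
    haveI : Fact (leastPrimeGe (n ^ (3 * c) * n ^ (3 * c) + n + 1)).Prime :=
      ⟨(leastPrimeGe_spec (n ^ (3 * c) * n ^ (3 * c) + n + 1)).2⟩
    have hkp : n ^ (b + 1) ≤ leastPrimeGe (n ^ (3 * c) * n ^ (3 * c) + n + 1) :=
      calc n ^ (b + 1) ≤ n ^ (6 * c) := Nat.pow_le_pow_right (by omega) (by omega)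
        _ = n ^ (3 * c) * n ^ (3 * c) := by rw [← pow_add]; ring_nf
        _ ≤ leastPrimeGe (n ^ (3 * c) * n ^ (3 * c) + n + 1) :=
            le_trans (Nat.le_add_right (n ^ (3 * c) * n ^ (3 * c)) (n + 1))
              (leastPrimeGe_spec (n ^ (3 * c) * n ^ (3 * c) + n + 1)).1
    have hm : 2 ≤ n ^ (3 * c) :=
      calc 2 ≤ n := by omega
        _ ≤ n ^ (3 * c) := Nat.le_self_pow (by omega) n
    exact hn₁ n (by omega) _ _ hm _ hkp (h n (by omega))
  exact key _ le_rfl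

/-- The per-seed grade of `krstNoGoBelow6c` (same generator, `IsSuccinctGenerator` in place of
`IsIdealSuccinctGenerator`; per-seed ⇒ ideal over a field, `KRSTEdge.IsSuccinctGenerator.ideal`). -/
theorem krstNoGoBelow6c_perSeed : ∀ c b : ℕ, b < 6 * c → ¬ (∃ n₀ : ℕ, ∀ n ≥ n₀,
    IsSuccinctGenerator (degLEMonomials n) (SmallCircuits ℂ n b)
      (@krstGen ℂ _ (leastPrimeGe (n ^ (3 * c) * n ^ (3 * c) + n + 1)) n
        ⟨(leastPrimeGe_spec (n ^ (3 * c) * n ^ (3 * c) + n + 1)).2⟩ (n ^ (3 * c))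
        (le_trans (Nat.le_add_right (n ^ (3 * c) * n ^ (3 * c)) (n + 1))
          (leastPrimeGe_spec (n ^ (3 * c) * n ^ (3 * c) + n + 1)).1))) := by
  rintro c b hbc ⟨n₀, h⟩
  refine krstNoGoBelow6c c b hbc ⟨n₀, fun n hn => ?_⟩
  haveI : Fact (leastPrimeGe (n ^ (3 * c) * n ^ (3 * c) + n + 1)).Prime :=
    ⟨(leastPrimeGe_spec (n ^ (3 * c) * n ^ (3 * c) + n + 1)).2⟩
  exact KRSTEdge.IsSuccinctGenerator.ideal (h n hn)

/-! ### The Literature / KRSTDoor hypothesis `KRSTSuccinctInVP ℂ c b` below `6c` -/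

/-- **The succinct-generator hypothesis `KRSTSuccinctInVP ℂ c b` is false for every `b < 6c`**
(successor of `KRSTEdge.not_KRSTSuccinctInVP`, which needed `5b + 24 ≤ 6c`): over `ℂ`, KRST's
generator with hardness exponent `c` (block `krstBlock c n = n^{3c}`, field size
`krstPrime c n ≥ n^{6c}`) is NOT `SmallCircuits ℂ n b`-succinct for any large `n` — unconditionally
(transversal of size `≥ n^{b+1}`, equations of the class on any `4 n^b + 2` coordinates).
[cite: KumarRamyaSaptharishiTengse2022, §4] -/
theorem not_KRSTSuccinctInVP_of_lt (c b : ℕ) (hbc : b < 6 * c) : ¬ KRSTSuccinctInVP ℂ c b := by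
  rintro ⟨n₀, h⟩
  obtain ⟨n₂, hn₂⟩ := LowDegreeEquations.eventually_mul_pow_le_two_pow 1 (b + 1)
  have key : ∀ n : ℕ, n₀ + n₂ + 6 ≤ n → False := by
    intro n hn
    have hk : 4 * n ^ b + 1 < n ^ (b + 1) := four_mul_pow_add_two_le b (by omega)
    have hkn : n ^ (b + 1) ≤ 2 ^ n := by
      have h2 := hn₂ n (by omega)
      rwa [one_mul] at h2
    have hkp : n ^ (b + 1) ≤ krstPrime c n :=
      calc n ^ (b + 1) ≤ n ^ (6 * c) := Nat.pow_le_pow_right (by omega) (by omega)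
        _ = krstBlock c n * krstBlock c n := by
            rw [krstBlock, ← pow_add, show 3 * c + 3 * c = 6 * c by omega]
        _ ≤ krstPrime c n := krstBlock_sq_le_krstPrime c n
    have hm : 2 ≤ krstBlock c n :=
      calc 2 ≤ n := by omega
        _ ≤ n ^ (3 * c) := Nat.le_self_pow (by omega) n
    exact krst_not_succinctIn_of_lt hm (krstBlock_sq_le_krstPrime c n) hkp hkn hk (h n (by omega))
  exact key _ le_rfl

/-- Hence the conditional `VP` statement `KRSTDoor.succinctHittingSetsForVP_of_permanentExpHard`
(hardness ∧ `KRSTSuccinctInVP ℂ c b` ⇒ FSV Question 6) has a satisfiable second hypothesis over `ℂ`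
only if `6c ≤ b`: the band in which the succinct-generator conjecture for KRST's design is open is
`b ≥ 6c` (there the seed dimension `p² ≈ n^{12c}` exceeds the number of coordinates visible to any
counting method). [cite: KumarRamyaSaptharishiTengse2022, §4] -/
theorem le_of_KRSTSuccinctInVP {c b : ℕ} (h : KRSTSuccinctInVP ℂ c b) : 6 * c ≤ b := by
  by_contra hlt
  exact not_KRSTSuccinctInVP_of_lt c b (not_le.mp hlt) h

end KRSTEdge

end Summit.ValiantsHypothesis.ValiantsHypothesis.Theorems.BarrierLever.SuccinctHittingSetsForVP

end
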